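import Mathlib
import HarnessLib
import Summits.HubbardSuperconductivity.HubbardSuperconductivity.Theorems.KLProgrammeKLRegimeTwoVolumeTowerBaseGridLimitDeg
import Summits.HubbardSuperconductivity.HubbardSuperconductivity.Theorems.KLProgrammeKLRegimeTwoVolumeTowerGenericFacts
import Summits.HubbardSuperconductivity.HubbardSuperconductivity.Theorems.KLProgrammeKLRegimeTwoVolumeTowerDataDefs
import Summits.HubbardSuperconductivity.HubbardSuperconductivity.Theorems.KLProgrammeKLRegimeTwoVolumeTowerTransferWtData
import Summits.HubbardSuperconductivity.HubbardSuperconductivity.Theorems.KLProgrammeKLRegimeTwoVolumeTowerDataOfPartsDeg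
import Summits.HubbardSuperconductivity.HubbardSuperconductivity.Theorems.KLProgrammeKLRegimeTwoVolumeTowerSrcScaledKit

/-!
# Route `KLProgramme` — crux K3, VL child `KLRegimeVolumeLimitV17F2` (stmt-HubbardSuperconductivity-20440), blueprint v5 M5: THE SOURCE-RESCALED TRUNCATED
# DATA PACKAGE FROM ITS PARTS (located «SRC-DEG2», cure (β) of plan g22 (R171); seat hubbard-kl-k3c4-p1 g15; `--supports` 20440)

Twin of `…TwoVolumeTowerTruncOfParts` (p619005) for `…TowerSrcScaledDefs.TowerDataTS β U μ t`, `0 ≤ t ≤ 1`: the constructor of record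
**`towerDataTS_of_partsD`** — fields (H1)–(H5) verbatim (the one-volume bundles being `TowerVolumeDataTS … t`: E1's alive read-out ⊕ token #24 with the source
families weighed `S₀ + t·S₁ + t²·S₂`), canonical radius `r_L = L/(4·nScales β+7)`, and the BASE (H6) from the UNSCALED base data of the W4 chain
(`…TowerDataOfPartsDeg.towerData_h0_canonicalD`; the rescaled truncated keyed defect is dominated by the truncated one, `…TowerSrcScaledKit.klKeyedDefectTS_le_klKeyedDefectT`,
and that by the untruncated one, `…TowerTruncDefs.klKeyedDefectT_le`) — so k3c4-p2's base atoms are UNCHANGED; and the one-scale window **`towerDataTS_thin`**.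

Proofs only; no definition.  Honest framing: conditional constructors; nothing here asserts the data, the stub, K3 or superconductivity.
-/

noncomputable section

namespace Summit.HubbardSuperconductivity.HubbardSuperconductivity.Theorems.TwoVolumeSource

set_option linter.dupNamespace false -- summit = problem name (single-conjunct summit), D-0017

open Finset Filter Topology Literature.MathematicalPhysics.QuantumLattice GrassmannAlgebra Literature.Probability.LatticeModels
  Literature.Probability.LatticeModels.BattleFederbush
open Literature.MathematicalPhysics.QuantumLattice.FermiRG
open Summit.HubbardSuperconductivity.HubbardSuperconductivity.Theorems.KLProgrammeLegKernels
open Summit.HubbardSuperconductivity.HubbardSuperconductivity.Theorems.KLRegimeSplit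
open Summit.HubbardSuperconductivity.HubbardSuperconductivity.Theorems.TwoPointAssembly
open Summit.HubbardSuperconductivity.HubbardSuperconductivity.Theorems.EngineV8
open Summit.HubbardSuperconductivity.HubbardSuperconductivity.Theorems.TwoVolumeDefect

/-- **`TowerDataTS β U μ t` FROM ITS PARTS, grid scaling, `t ∈ [0,1]`** (see the module docstring): fields (H1)–(H5) verbatim, canonical radius, base from the
UNSCALED base data (the rescaled truncated base defect is dominated by it). [folklore] -/
theorem towerDataTS_of_partsD (β U μ : ℝ) (hβ : 0 < β) {t : ℝ} (ht0 : 0 ≤ t) (ht1 : t ≤ 1) (Mth : ℕ → ℕ → ℕ)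
    (hMth : ∀ L b M, Mth L b ≤ M → 0 < imagTimeWeight β M)
    -- (H1)–(H5): the fields of `TowerData` other than `Mth, r, hr, hRd, h0`, verbatim
    (Λ : ℕ → ℝ)
    (κ : ℕ → ℝ)
    (aW : ℕ → ℝ)
    (sW : ℕ → ℝ)
    (κ' : ℕ → ℝ)
    (aW' : ℕ → ℝ)
    (sW' : ℕ → ℝ)
    (eW' : ℕ → ℝ)
    (ΛT : ℕ → ℝ)
    (cW : ℕ → ℝ)
    (κf : ℕ → ℝ)
    (cRb : ℕ → ℝ)
    (cCb : ℕ → ℝ)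
    (δb : ℕ → ℝ)
    (ρ₀ : ℕ → ℝ)
    (ρf : ℕ → ℝ)
    (ρ₂ : ℕ → ℝ)
    (ρ' : ℕ → ℝ)
    (ρ₃ : ℕ → ℝ)
    (ν₀ : ℕ → ℝ)
    (ν₁ : ℕ → ℝ)
    (ν₂ : ℕ → ℝ)
    (ν₃ : ℕ → ℝ)
    (ν₄ : ℕ → ℝ)
    (ν₅ : ℕ → ℝ)
    (νE : ℕ → ℝ)
    (ν₆ : ℕ → ℝ)
    (ν₇ : ℕ → ℝ)
    (ν₈ : ℕ → ℝ)
    (NV : ℕ → ℕ → ℝ)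
    (NS : ℕ → ℕ → ℝ)
    (sE : ℕ → ℕ → ℝ)
    (cR : ℕ → ℕ → ℝ)
    (cC : ℕ → ℕ → ℝ)
    (δ : ℕ → ℕ → ℝ)
    (hΛ : ∀ j, 0 < Λ j)
    (hΛmono : ∀ j, Λ (j + 1) ≤ Λ j)
    (hΛT : ∀ j, Λ j ≤ ΛT j)
    (hκ : ∀ j, 0 < κ j ∧ 0 < κ' j ∧ 0 < κf j)
    (haW : ∀ j, 0 ≤ aW j ∧ 0 ≤ aW' j ∧ 0 ≤ sW j ∧ 0 ≤ sW' j ∧ 0 ≤ eW' j ∧ 0 ≤ cW j ∧ 0 ≤ δb j)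
    (hρ : ∀ j, 0 < ρ₀ j ∧ 0 < ρf j ∧ 0 < ρ₂ j ∧ 0 < ρ' j ∧ 0 < ρ₃ j)
    (hNV0 : ∀ j m, 0 ≤ NV j m)
    (hNSnn : ∀ j k, 0 ≤ NS j k)
    (hNS0 : ∀ k, NS 0 k = if Even k then NV 0 (k / 2) else 0)
    (hNSsucc : ∀ j k, j < nScales β → NS (j + 1) k = (ρ₀ j)⁻¹ ^ k * (Real.exp 1 * ν₀ j) / (1 - Real.exp 1 * aW j * ν₀ j / κ j ^ 2))
    (hsm : ∀ j, j < nScales β → TowerScaleSmall (κ j) (κ' j) (aW j) (aW' j) (cW j) (κf j) (cRb j) (cCb j) (δb j) (ρ₀ j) (ρf j) (ρ₂ j) (ρ' j) (ρ₃ j) (NV j) (NS j)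
      (ν₀ j) (ν₁ j) (ν₂ j) (ν₃ j) (ν₄ j) (ν₅ j) (νE j) (ν₆ j) (ν₇ j) (ν₈ j))
    (hmis : ∀ j L, 0 ≤ sE j L ∧ 0 ≤ cR j L ∧ 0 ≤ cC j L ∧ 0 ≤ δ j L ∧ cR j L ≤ cRb j ∧ cC j L ≤ cCb j ∧ δ j L ≤ δb j)
    (hmis0 : ∀ j, Tendsto (sE j) atTop (𝓝 0) ∧ Tendsto (cR j) atTop (𝓝 0) ∧ Tendsto (cC j) atTop (𝓝 0) ∧ Tendsto (δ j) atTop (𝓝 0))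
    (hdata : ∀ᶠ L in atTop, ∀ (b M : ℕ) [NeZero L] [NeZero (b * L)] [NeZero M], Mth L b ≤ M →
      TowerVolumeDataTS L M β U μ (klFlowFrameU L M β U μ (nScales β + 1)) (nScales β) (imagTimeWeight β M) t Λ κ aW sW NV ∧
      TowerVolumeDataTS (b * L) M β U μ (klFlowFrameU (b * L) M β U μ (nScales β + 1)) (nScales β) (imagTimeWeight β M) t Λ κ aW sW NV ∧
      TowerCrossData L b M β μ (klFlowFrameU L M β U μ (nScales β + 1)) (klFlowFrameU (b * L) M β U μ (nScales β + 1)) (nScales β) (imagTimeWeight β M)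
      Λ κ' aW' sW' eW' ΛT cW κf (fun j => sE j L) (fun j => cR j L) (fun j => cC j L) (fun j => δ j L))
    -- the base-transfer data of `…TowerBase`
    {ΛgT cgW Λg δgb : ℝ} (hgΛT : 0 < ΛgT) (hcW : 0 ≤ cgW) (hΛg : 0 < Λg) (NG : ℕ → ℝ) (hNG0 : ∀ k, 0 ≤ NG k)
    (δg : ℕ → ℝ) (hgδ : ∀ L, 0 ≤ δg L ∧ δg L ≤ δgb) (hgδ0 : Tendsto δg atTop (𝓝 0))
    (hdataT : ∀ᶠ L in atTop, ∀ (b M : ℕ) [NeZero L] [NeZero (b * L)] [NeZero M], Mth L b ≤ M →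
      (∀ x : SrcLabel (b * L) M 0, ∑ y, ‖klBaseTransfer (b * L) M β μ (klFlowFrameU L M β U μ (nScales β + 1)) x y‖ * (1 + ΛgT * (Torus.tnorm (x.1.1.2 - y.1.1.1.2) : ℝ)) ≤ cgW) ∧
      (∀ y : GridLeg (GridPoint (b * L) (klGridN M)) × Fin 2, ∑ x, ‖klBaseTransfer (b * L) M β μ (klFlowFrameU L M β U μ (nScales β + 1)) x y‖ * (1 + ΛgT * (Torus.tnorm (x.1.1.2 - y.1.1.1.2) : ℝ)) ≤ cgW) ∧
      (∀ (δ' β' β₁ : Fin 2 → Fin b) (xbar : SrcLabel L M 0) (y : GridLeg (GridPoint L (klGridN M)) × Fin 2),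
        ‖klBaseTransfer (b * L) M β μ (klFlowFrameU L M β U μ (nScales β + 1)) ((klBlockEquivD L b M 0).symm (β' + δ', xbar)) ((klGridBlockEquivD L b M).symm (β₁ + δ', y))‖ =
          ‖klBaseTransfer (b * L) M β μ (klFlowFrameU L M β U μ (nScales β + 1)) ((klBlockEquivD L b M 0).symm (β', xbar)) ((klGridBlockEquivD L b M).symm (β₁, y))‖) ∧
      (∀ x, ∑ y, ‖klBaseTransfer (b * L) M β μ (klFlowFrameU (b * L) M β U μ (nScales β + 1)) x y - klBaseTransfer (b * L) M β μ (klFlowFrameU L M β U μ (nScales β + 1)) x y‖ ≤ δg L) ∧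
      (∀ y, ∑ x, ‖klBaseTransfer (b * L) M β μ (klFlowFrameU (b * L) M β U μ (nScales β + 1)) x y - klBaseTransfer (b * L) M β μ (klFlowFrameU L M β U μ (nScales β + 1)) x y‖ ≤ δg L) ∧
      (∀ (k : ℕ) (p : Fin k) (y : GridLeg (GridPoint L (klGridN M))),
        ∑ Y ∈ univ.filter (fun Y : Fin k → GridLeg (GridPoint L (klGridN M)) => Y p = y),
          ‖kernel ℂ (klGridAction L M β U μ (klFlowFrameU L M β U μ (nScales β + 1))) k Y‖ *
            (1 + labelDiam (fun Y₁ Y₂ : GridLeg (GridPoint L (klGridN M)) => Λg * (Torus.tnorm (Y₁.1.1.2 - Y₂.1.1.2) : ℝ)) (univ.image Y)) ≤ imagTimeWeight β M * NG k) ∧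
      (∀ (k : ℕ) (p : Fin k) (y : GridLeg (GridPoint (b * L) (klGridN M))),
        ∑ Y ∈ univ.filter (fun Y : Fin k → GridLeg (GridPoint (b * L) (klGridN M)) => Y p = y),
          ‖kernel ℂ (klGridAction (b * L) M β U μ (klFlowFrameU (b * L) M β U μ (nScales β + 1))) k Y‖ *
            (1 + labelDiam (fun Y₁ Y₂ : GridLeg (GridPoint (b * L) (klGridN M)) => Λg * (Torus.tnorm (Y₁.1.1.2 - Y₂.1.1.2) : ℝ)) (univ.image Y)) ≤ imagTimeWeight β M * NG k))
    -- the grid data, grid scaling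
    {κE aC cb κg κg' ρS ρg' ρg₂ ρgf aw al al' mo mo' s s' Θ νW νf νg₂ νD : ℝ}
    (hκE : 0 < κE) (haC : 0 < aC) (hgκ : 0 < κg) (hgκ' : 0 < κg') (hρS : 0 < ρS) (hgρ' : 0 < ρg') (hgρ₂ : 0 < ρg₂) (hgρf : 0 < ρgf) (haw : 0 < aw)
    (haa : 0 < al' + al) (hm0 : 0 ≤ mo) (hm0' : 0 ≤ mo') (hs0 : 0 ≤ s) (hs'0 : 0 ≤ s') (hΘ0 : 0 ≤ Θ) (hνW0 : 0 ≤ νW) (hνf0 : 0 ≤ νf) (hν₂0 : 0 ≤ νg₂)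
    (hθS : Real.exp 1 * (aC + cb) * νW / κE ^ 2 < 1) (hθΘ : Real.exp 1 * aw * Θ / κg' ^ 2 < 1)
    (hθf : Real.exp 1 * (al' + al + (mo' + mo)) * νf / (κg' + κg) ^ 2 < 1) (hθ₂ : Real.exp 1 * (al' + al + (mo' + mo)) * νg₂ / (κg' + κg + (κg' + κg + (κg' + κg))) ^ 2 < 1)
    (sgE cc eE tT Te : ℕ → ℝ) (D₀ : ℕ)
    (hrate : ∀ L, 0 ≤ sgE L ∧ 0 ≤ cc L ∧ 2 * cc L ≤ cb ∧ 0 < tT L ∧ 0 ≤ Te L)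
    (hsE0 : Tendsto sgE atTop (𝓝 0)) (hcc0 : Tendsto cc atTop (𝓝 0)) (heE0 : Tendsto eE atTop (𝓝 0)) (htT0 : Tendsto tT atTop (𝓝 0))
    (hTe0 : Tendsto Te atTop (𝓝 0))
    (hgdata : ∀ᶠ L in atTop, ∀ (b M : ℕ) [NeZero L] [NeZero (b * L)] [NeZero M], Mth L b ≤ M →
      Nonempty (TowerGridDataD L b M β U μ (klFlowFrameU L M β U μ (nScales β + 1)) (klFlowFrameU (b * L) M β U μ (nScales β + 1)) (imagTimeWeight β M) κE aC κg κg' ρS ρg' ρg₂ ρgf aw al al' mo mo' s s' Θ νW νf νg₂ νD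
        (sgE L) (cc L) (eE L) (tT L) (Te L) (Nat.sqrt (L / (4 * nScales β + 7))) ((L / (4 * nScales β + 7)) - Nat.sqrt (L / (4 * nScales β + 7))) D₀))
 :
    Nonempty (TowerDataTS β U μ t) :=
  ⟨{
    Mth := Mth
    r := fun L => L / (4 * nScales β + 7)
    hr := tower_radius_tendsto β
    hRd := tower_radius_deep β
    Λ := Λ
    κ := κ
    aW := aW
    sW := sW
    κ' := κ'
    aW' := aW'
    sW' := sW'
    eW' := eW'
    ΛT := ΛT
    cW := cW
    κf := κf
    cRb := cRb
    cCb := cCb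
    δb := δb
    ρ₀ := ρ₀
    ρf := ρf
    ρ₂ := ρ₂
    ρ' := ρ'
    ρ₃ := ρ₃
    ν₀ := ν₀
    ν₁ := ν₁
    ν₂ := ν₂
    ν₃ := ν₃
    ν₄ := ν₄
    ν₅ := ν₅
    νE := νE
    ν₆ := ν₆
    ν₇ := ν₇
    ν₈ := ν₈
    NV := NV
    NS := NS
    sE := sE
    cR := cR
    cC := cC
    δ := δ
    hΛ := hΛ
    hΛmono := hΛmono
    hΛT := hΛT
    hκ := hκ
    haW := haW
    hρ := hρ
    hNV0 := hNV0
    hNSnn := hNSnn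
    hNS0 := hNS0
    hNSsucc := hNSsucc
    hsm := hsm
    hmis := hmis
    hmis0 := hmis0
    hdata := hdata
    h0 := fun k η hη => by
      filter_upwards [towerData_h0_canonicalD β U μ hβ Mth hMth hgΛT hcW hΛg NG hNG0 δg hgδ hgδ0 hdataT hκE haC hgκ hgκ' hρS hgρ' hgρ₂ hgρf haw haa hm0 hm0'
        hs0 hs'0 hΘ0 hνW0 hνf0 hν₂0 hθS hθΘ hθf hθ₂ sgE cc eE tT Te D₀ hrate hsE0 hcc0 heE0 htT0 hTe0 hgdata k η hη] with L hL
      intro b M _ _ _ hM p w hw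
      exact (klKeyedDefectTS_le_klKeyedDefectT β U μ _ _ ht0 ht1 0 k p w).trans ((klKeyedDefectT_le β U μ _ _ 0 k p w).trans (hL b M hM p w hw)) }⟩

set_option maxHeartbeats 800000 in -- one large constructor application
/-- **`TowerDataTS β U μ t` IN THE ONE-SCALE WINDOW** (`nScales β = 0`, `t ∈ [0,1]`; see the module docstring). [folklore: assembly] -/
theorem towerDataTS_thin (β U μ : ℝ) (hβ : 0 < β) {t : ℝ} (ht0 : 0 ≤ t) (ht1 : t ≤ 1) (hJ : nScales β = 0) (Mth : ℕ → ℕ → ℕ)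
    (hMth : ∀ L b M, Mth L b ≤ M → 0 < imagTimeWeight β M)
    -- the scale-0 data at both volumes: partition function at `Λ_1` and E1's weighted even profile of the RESCALED `klTowerDS … t 0` at rate `Λ₀`, budget `ε_M · NV0`
    {Λ₀ : ℝ} (hΛ0 : 0 < Λ₀) (NV0 : ℕ → ℝ) (hNV0 : ∀ m, 0 ≤ NV0 m)
    (hthin : ∀ᶠ L in atTop, ∀ (b M : ℕ) [NeZero L] [NeZero (b * L)] [NeZero M], Mth L b ≤ M →
      (hubbardEffPartitionFnCT L M β U μ 0 (klFlowFrameU L M β U μ (nScales β + 1)) (klScale klE0 1) ≠ 0 ∧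
        WtProfileEven (srcTrunc ℂ (fun q : SrcLabel L M 0 => q.2 = 1) 3 (klTowerDS L M β U μ (klFlowFrameU L M β U μ (nScales β + 1)) t 0)) Λ₀
          (fun m => imagTimeWeight β M * NV0 m)) ∧
      (hubbardEffPartitionFnCT (b * L) M β U μ 0 (klFlowFrameU (b * L) M β U μ (nScales β + 1)) (klScale klE0 1) ≠ 0 ∧
        WtProfileEven (srcTrunc ℂ (fun q : SrcLabel (b * L) M 0 => q.2 = 1) 3 (klTowerDS (b * L) M β U μ (klFlowFrameU (b * L) M β U μ (nScales β + 1)) t 0)) Λ₀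
          (fun m => imagTimeWeight β M * NV0 m)))
    -- the base-transfer data of `…TowerBase`
    {ΛgT cgW Λg δgb : ℝ} (hgΛT : 0 < ΛgT) (hcW : 0 ≤ cgW) (hΛg : 0 < Λg) (NG : ℕ → ℝ) (hNG0 : ∀ k, 0 ≤ NG k)
    (δg : ℕ → ℝ) (hgδ : ∀ L, 0 ≤ δg L ∧ δg L ≤ δgb) (hgδ0 : Tendsto δg atTop (𝓝 0))
    (hdataT : ∀ᶠ L in atTop, ∀ (b M : ℕ) [NeZero L] [NeZero (b * L)] [NeZero M], Mth L b ≤ M →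
      (∀ x : SrcLabel (b * L) M 0, ∑ y, ‖klBaseTransfer (b * L) M β μ (klFlowFrameU L M β U μ (nScales β + 1)) x y‖ * (1 + ΛgT * (Torus.tnorm (x.1.1.2 - y.1.1.1.2) : ℝ)) ≤ cgW) ∧
      (∀ y : GridLeg (GridPoint (b * L) (klGridN M)) × Fin 2, ∑ x, ‖klBaseTransfer (b * L) M β μ (klFlowFrameU L M β U μ (nScales β + 1)) x y‖ * (1 + ΛgT * (Torus.tnorm (x.1.1.2 - y.1.1.1.2) : ℝ)) ≤ cgW) ∧
      (∀ (δ' β' β₁ : Fin 2 → Fin b) (xbar : SrcLabel L M 0) (y : GridLeg (GridPoint L (klGridN M)) × Fin 2),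
        ‖klBaseTransfer (b * L) M β μ (klFlowFrameU L M β U μ (nScales β + 1)) ((klBlockEquivD L b M 0).symm (β' + δ', xbar)) ((klGridBlockEquivD L b M).symm (β₁ + δ', y))‖ =
          ‖klBaseTransfer (b * L) M β μ (klFlowFrameU L M β U μ (nScales β + 1)) ((klBlockEquivD L b M 0).symm (β', xbar)) ((klGridBlockEquivD L b M).symm (β₁, y))‖) ∧
      (∀ x, ∑ y, ‖klBaseTransfer (b * L) M β μ (klFlowFrameU (b * L) M β U μ (nScales β + 1)) x y - klBaseTransfer (b * L) M β μ (klFlowFrameU L M β U μ (nScales β + 1)) x y‖ ≤ δg L) ∧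
      (∀ y, ∑ x, ‖klBaseTransfer (b * L) M β μ (klFlowFrameU (b * L) M β U μ (nScales β + 1)) x y - klBaseTransfer (b * L) M β μ (klFlowFrameU L M β U μ (nScales β + 1)) x y‖ ≤ δg L) ∧
      (∀ (k : ℕ) (p : Fin k) (y : GridLeg (GridPoint L (klGridN M))),
        ∑ Y ∈ univ.filter (fun Y : Fin k → GridLeg (GridPoint L (klGridN M)) => Y p = y),
          ‖kernel ℂ (klGridAction L M β U μ (klFlowFrameU L M β U μ (nScales β + 1))) k Y‖ *
            (1 + labelDiam (fun Y₁ Y₂ : GridLeg (GridPoint L (klGridN M)) => Λg * (Torus.tnorm (Y₁.1.1.2 - Y₂.1.1.2) : ℝ)) (univ.image Y)) ≤ imagTimeWeight β M * NG k) ∧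
      (∀ (k : ℕ) (p : Fin k) (y : GridLeg (GridPoint (b * L) (klGridN M))),
        ∑ Y ∈ univ.filter (fun Y : Fin k → GridLeg (GridPoint (b * L) (klGridN M)) => Y p = y),
          ‖kernel ℂ (klGridAction (b * L) M β U μ (klFlowFrameU (b * L) M β U μ (nScales β + 1))) k Y‖ *
            (1 + labelDiam (fun Y₁ Y₂ : GridLeg (GridPoint (b * L) (klGridN M)) => Λg * (Torus.tnorm (Y₁.1.1.2 - Y₂.1.1.2) : ℝ)) (univ.image Y)) ≤ imagTimeWeight β M * NG k))
    -- the grid data, grid scaling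
    {κE aC cb κg κg' ρS ρg' ρg₂ ρgf aw al al' mo mo' s s' Θ νW νf νg₂ νD : ℝ}
    (hκE : 0 < κE) (haC : 0 < aC) (hgκ : 0 < κg) (hgκ' : 0 < κg') (hρS : 0 < ρS) (hgρ' : 0 < ρg') (hgρ₂ : 0 < ρg₂) (hgρf : 0 < ρgf) (haw : 0 < aw)
    (haa : 0 < al' + al) (hm0 : 0 ≤ mo) (hm0' : 0 ≤ mo') (hs0 : 0 ≤ s) (hs'0 : 0 ≤ s') (hΘ0 : 0 ≤ Θ) (hνW0 : 0 ≤ νW) (hνf0 : 0 ≤ νf) (hν₂0 : 0 ≤ νg₂)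
    (hθS : Real.exp 1 * (aC + cb) * νW / κE ^ 2 < 1) (hθΘ : Real.exp 1 * aw * Θ / κg' ^ 2 < 1)
    (hθf : Real.exp 1 * (al' + al + (mo' + mo)) * νf / (κg' + κg) ^ 2 < 1) (hθ₂ : Real.exp 1 * (al' + al + (mo' + mo)) * νg₂ / (κg' + κg + (κg' + κg + (κg' + κg))) ^ 2 < 1)
    (sgE cc eE tT Te : ℕ → ℝ) (D₀ : ℕ)
    (hrate : ∀ L, 0 ≤ sgE L ∧ 0 ≤ cc L ∧ 2 * cc L ≤ cb ∧ 0 < tT L ∧ 0 ≤ Te L)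
    (hsE0 : Tendsto sgE atTop (𝓝 0)) (hcc0 : Tendsto cc atTop (𝓝 0)) (heE0 : Tendsto eE atTop (𝓝 0)) (htT0 : Tendsto tT atTop (𝓝 0))
    (hTe0 : Tendsto Te atTop (𝓝 0))
    (hgdata : ∀ᶠ L in atTop, ∀ (b M : ℕ) [NeZero L] [NeZero (b * L)] [NeZero M], Mth L b ≤ M →
      Nonempty (TowerGridDataD L b M β U μ (klFlowFrameU L M β U μ (nScales β + 1)) (klFlowFrameU (b * L) M β U μ (nScales β + 1)) (imagTimeWeight β M) κE aC κg κg' ρS ρg' ρg₂ ρgf aw al al' mo mo' s s' Θ νW νf νg₂ νD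
        (sgE L) (cc L) (eE L) (tT L) (Te L) (Nat.sqrt (L / (4 * nScales β + 7))) ((L / (4 * nScales β + 7)) - Nat.sqrt (L / (4 * nScales β + 7))) D₀))
 :
    Nonempty (TowerDataTS β U μ t) := by
  have hvac : ∀ j : ℕ, ¬ j < nScales β := fun j hj => by rw [hJ] at hj; exact Nat.not_lt_zero j hj
  have hle0 : ∀ j : ℕ, j ≤ nScales β → j = 0 := fun j hj => by rw [hJ] at hj; exact Nat.le_zero.1 hj
  refine towerDataTS_of_partsD β U μ hβ ht0 ht1 Mth hMth (fun _ => Λ₀) (fun _ => 1) (fun _ => 0) (fun _ => 0) (fun _ => 1) (fun _ => 0) (fun _ => 0) (fun _ => 0)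
    (fun _ => Λ₀) (fun _ => 1) (fun _ => 1) (fun _ => 0) (fun _ => 0) (fun _ => 0) (fun _ => 1) (fun _ => 1) (fun _ => 1) (fun _ => 1) (fun _ => 1)
    (fun _ => 0) (fun _ => 0) (fun _ => 0) (fun _ => 0) (fun _ => 0) (fun _ => 0) (fun _ => 0) (fun _ => 0) (fun _ => 0) (fun _ => 0)
    (fun _ m => NV0 m) (fun _ k => if Even k then NV0 (k / 2) else 0) (fun _ _ => 0) (fun _ _ => 0) (fun _ _ => 0) (fun _ _ => 0)
    (fun _ => hΛ0) (fun _ => le_rfl) (fun _ => le_rfl) (fun _ => ⟨one_pos, one_pos, one_pos⟩)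
    (fun _ => ⟨le_rfl, le_rfl, le_rfl, le_rfl, le_rfl, zero_le_one, le_rfl⟩) (fun _ => ⟨one_pos, one_pos, one_pos, one_pos, one_pos⟩)
    (fun _ m => hNV0 m) (fun _ k => ?_) (fun _ => rfl) (fun j _ hj => absurd hj (hvac j)) (fun j hj => absurd hj (hvac j))
    (fun _ _ => ⟨le_rfl, le_rfl, le_rfl, le_rfl, le_rfl, le_rfl, le_rfl⟩)
    (fun _ => ⟨tendsto_const_nhds, tendsto_const_nhds, tendsto_const_nhds, tendsto_const_nhds⟩) ?_
    hgΛT hcW hΛg NG hNG0 δg hgδ hgδ0 hdataT hκE haC hgκ hgκ' hρS hgρ' hgρ₂ hgρf haw haa hm0 hm0' hs0 hs'0 hΘ0 hνW0 hνf0 hν₂0 hθS hθΘ hθf hθ₂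
    sgE cc eE tT Te D₀ hrate hsE0 hcc0 heE0 htT0 hTe0 hgdata
  · -- `0 ≤ NS j k`
    split_ifs
    · exact hNV0 _
    · exact le_rfl
  · -- (H5) at `J = nScales β = 0`: parity(0) + profile(0) at both volumes, the identity transfer, everything else vacuous
    filter_upwards [hthin] with L hL
    intro b M _ _ _ hM
    obtain ⟨⟨hZc, hPc⟩, hZf, hPf⟩ := hL b M hM
    refine ⟨⟨fun k hk => absurd (Nat.lt_of_succ_le hk) (hvac k), fun j hj => ?_, fun j hj => absurd hj (hvac j), fun j hj => ?_⟩,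
      ⟨fun k hk => absurd (Nat.lt_of_succ_le hk) (hvac k), fun j hj => ?_, fun j hj => absurd hj (hvac j), fun j hj => ?_⟩,
      ⟨fun j hj => absurd hj (hvac j), fun j hj => absurd hj (hvac j), fun j hj => ?_, fun j hj => absurd hj (hvac j),
        fun j hj => absurd hj (hvac j), fun j hj => absurd hj (hvac j), fun j hj => absurd hj (hvac j), fun j hj x => ?_, fun j hj y => ?_⟩⟩
    · obtain rfl := hle0 j hj; exact klTowerD_parity β U μ _ 0 hZc
    · obtain rfl := hle0 j hj; exact hPc
    · obtain rfl := hle0 j hj; exact klTowerD_parity β U μ _ 0 hZf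
    · obtain rfl := hle0 j hj; exact hPf
    · obtain rfl := hle0 j hj
      rw [klTowerTransfer_zero]
      exact TorusFourierL2.transferWtData_one _ hΛ0.le le_rfl
    · obtain rfl := hle0 j hj
      rw [TorusFourierL2.sum_norm_klTowerTransfer_zero_sub_row]
    · obtain rfl := hle0 j hj
      rw [TorusFourierL2.sum_norm_klTowerTransfer_zero_sub_col]

end Summit.HubbardSuperconductivity.HubbardSuperconductivity.Theorems.TwoVolumeSource

end
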